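import Literature.MathematicalPhysics.KineticTheory.VelocityAverageOperator
import HarnessLib

/-!
# `A A*` is a space-time convolution: the `TT*` kernel of velocity averaging

Topic: MathematicalPhysics / KineticTheory. Fourth file of the Fourier-free proof of the `L¹`
velocity-averaging lemma (CIP 1994 Lemma 5.3.9; see the header of `VelocityAverageOperator`).
For the averaged Duhamel operator `A = avgDuhamel ψ₀ S` and its adjoint `A* = adjAvgDuhamel ψ₀ S`
one computes, for bounded measurable `G` on space-time `ℝ × E`,

  `(A A* G)(t, x) = ∫ dξ ψ₀(ξ)² ∫∫_{(0,S)²} G(t - (s - s'), x - (s - s')ξ) ds ds'`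
  `             = ∫ dσ W_S(σ) ∫ dξ ψ₀(ξ)² G(t - σ, x - σξ)`        (`σ = s - s'`)
  `             = ∫ dσ ∫ dz W_S(σ) |σ|^{-d} ψ₀(z/σ)² G(t - σ, x - z)`  (`z = σξ`, `d = dim E`)
  `             = (κ ∗ G)(t, x)`,

with the window overlap `W_S(σ) = |{s' ∈ (0,S) : σ + s' ∈ (0,S)}|` (`lagOverlap S σ`) and the
**`TT*` kernel** `κ(σ, z) = W_S(σ) |σ|^{-d} ψ₀(z/σ)²` (`ttKernel ψ₀ S`), an integrable function on
`ℝ × E` (`integrable_ttKernel`; `∫ κ = (∫ W_S) ‖ψ₀‖₂²` by scaling back). This is the dispersion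
mechanism of free transport (Saint-Raymond 2009, §3.3.2: "a set of small measure in `x` is changed
into a set of small measure in `v`") in `TT*` form. Main result:
`avgDuhamel_adjAvgDuhamel_eq` (`A A* G = κ ∗ G` pointwise). Everything is proved.

## References

* C. Cercignani, R. Illner, M. Pulvirenti, *The Mathematical Theory of Dilute Gases*, Springer
  (1994), §5.3, proof of Lemma 5.3.9, p. 155. [CIPDiluteGases1994]
* L. Saint-Raymond, *Hydrodynamic Limits of the Boltzmann Equation*, LNM 1971 (2009), §3.3.2,
  Prop. 3.3.3 (dispersion of the free transport operator). [SaintRaymond2009]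
-/

noncomputable section

open MeasureTheory Set Filter Function Metric Module
open _root_.Topology
open scoped ENNReal NNReal

namespace Literature.MathematicalPhysics.KineticTheory

/-! ## The window overlap function -/

section Overlap

/-- The **window overlap** `W_S(σ) = |{s' ∈ (0, S) : σ + s' ∈ (0, S)}|`, written as an integral
(it equals `(S - |σ|)₊`, which is not needed). [folklore] -/
def lagOverlap (S σ : ℝ) : ℝ :=
  ∫ s' in Ioo (0 : ℝ) S, (Ioo (0 : ℝ) S).indicator (fun _ => (1 : ℝ)) (σ + s')

/-- Unfolding of `lagOverlap`. [folklore] -/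
theorem lagOverlap_apply (S σ : ℝ) : lagOverlap S σ =
    ∫ s' in Ioo (0 : ℝ) S, (Ioo (0 : ℝ) S).indicator (fun _ => (1 : ℝ)) (σ + s') := rfl

/-- The overlap integrand is jointly measurable. [folklore] -/
theorem measurable_overlap_integrand (S : ℝ) :
    Measurable fun q : ℝ × ℝ => (Ioo (0 : ℝ) S).indicator (fun _ => (1 : ℝ)) (q.1 + q.2) :=
  (measurable_const.indicator measurableSet_Ioo).comp (measurable_fst.add measurable_snd)

/-- `W_S` is measurable. [folklore] -/
theorem measurable_lagOverlap (S : ℝ) : Measurable (lagOverlap S) :=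
  ((measurable_overlap_integrand S).stronglyMeasurable.integral_prod_right'
    (ν := (volume : Measure ℝ).restrict (Ioo 0 S))).measurable

/-- `0 ≤ W_S`. [folklore] -/
theorem lagOverlap_nonneg (S σ : ℝ) : 0 ≤ lagOverlap S σ :=
  integral_nonneg fun _ => indicator_nonneg (fun _ _ => zero_le_one) _

/-- `W_S ≤ S` for `0 ≤ S`. [folklore] -/
theorem lagOverlap_le {S : ℝ} (hS : 0 ≤ S) (σ : ℝ) : lagOverlap S σ ≤ S := by
  have h := norm_setIntegral_le_of_norm_le_const (μ := (volume : Measure ℝ)) (s := Ioo (0 : ℝ) S)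
    (f := fun s' => (Ioo (0 : ℝ) S).indicator (fun _ => (1 : ℝ)) (σ + s')) (C := 1) (by simp)
    fun s' _ => by
      rw [Real.norm_eq_abs, abs_of_nonneg (indicator_nonneg (fun _ _ => zero_le_one) _)]
      exact indicator_le_self' (fun _ _ => zero_le_one) _
  change ‖lagOverlap S σ‖ ≤ 1 * volume.real (Ioo (0 : ℝ) S) at h
  rw [Real.volume_real_Ioo_of_le hS, sub_zero, one_mul, Real.norm_eq_abs,
    abs_of_nonneg (lagOverlap_nonneg S σ)] at h
  exact h

/-- `W_S(σ) = 0` for `|σ| ≥ S`. [folklore] -/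
theorem lagOverlap_eq_zero {S σ : ℝ} (hσ : S ≤ |σ|) : lagOverlap S σ = 0 := by
  refine setIntegral_eq_zero_of_forall_eq_zero fun s' hs' => indicator_of_notMem (fun h => ?_) _
  rcases le_abs'.1 hσ with h1 | h1
  · linarith [h.1, hs'.2]
  · linarith [h.2, hs'.1]

/-- **The lag pushforward**: for bounded measurable `f`,
`∫_{(0,S)} ∫_{(0,S)} f(s - s') ds' ds = ∫ W_S(σ) f(σ) dσ` (Fubini and the translation
`s = σ + s'`). [folklore] -/
theorem integral_integral_sub_eq_integral_lagOverlap_mul {S : ℝ} {f : ℝ → ℝ}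
    (hfm : Measurable f) {C : ℝ} (hfC : ∀ σ, |f σ| ≤ C) :
    ∫ s in Ioo (0 : ℝ) S, ∫ s' in Ioo (0 : ℝ) S, f (s - s') = ∫ σ, lagOverlap S σ * f σ := by
  haveI : IsFiniteMeasure ((volume : Measure ℝ).restrict (Ioo (0 : ℝ) S)) := ⟨by simp⟩
  have hC : 0 ≤ C := (abs_nonneg _).trans (hfC 0)
  -- Step 1: swap the two lag integrals
  have h1 : Integrable (uncurry fun s s' : ℝ => f (s - s'))
      (((volume : Measure ℝ).restrict (Ioo (0 : ℝ) S)).prod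
        ((volume : Measure ℝ).restrict (Ioo (0 : ℝ) S))) := by
    refine ⟨(hfm.comp (measurable_fst.sub measurable_snd)).aestronglyMeasurable, ?_⟩
    exact HasFiniteIntegral.of_bounded (C := C) (ae_of_all _ fun q =>
      (Real.norm_eq_abs _).le.trans (hfC _))
  rw [integral_integral_swap h1]
  -- Step 2: inner substitution `s = σ + s'`
  have h2 : ∀ s' : ℝ, ∫ s in Ioo (0 : ℝ) S, f (s - s') =
      ∫ σ, (Ioo (0 : ℝ) S).indicator (fun _ => (1 : ℝ)) (σ + s') * f σ := by
    intro s'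
    have e1 : ∫ s in Ioo (0 : ℝ) S, f (s - s') =
        ∫ s, (fun σ => (Ioo (0 : ℝ) S).indicator (fun _ => (1 : ℝ)) (σ + s') * f σ) (s - s') := by
      rw [← MeasureTheory.integral_indicator measurableSet_Ioo]
      refine integral_congr_ae (ae_of_all _ fun s => ?_)
      dsimp only
      rw [sub_add_cancel]
      by_cases hs : s ∈ Ioo (0 : ℝ) S
      · rw [indicator_of_mem hs, indicator_of_mem hs, one_mul]
      · rw [indicator_of_notMem hs, indicator_of_notMem hs, zero_mul]
    rw [e1]
    exact integral_sub_right_eq_self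
      (fun σ => (Ioo (0 : ℝ) S).indicator (fun _ => (1 : ℝ)) (σ + s') * f σ) s'
  have h2' : ∫ s' in Ioo (0 : ℝ) S, ∫ s in Ioo (0 : ℝ) S, f (s - s') =
      ∫ s' in Ioo (0 : ℝ) S, ∫ σ, (Ioo (0 : ℝ) S).indicator (fun _ => (1 : ℝ)) (σ + s') * f σ :=
    setIntegral_congr_fun measurableSet_Ioo fun s' _ => h2 s'
  rw [h2']
  -- Step 3: Fubini on `(0,S) × ℝ`
  have h3 : Integrable
      (uncurry fun (s' σ : ℝ) => (Ioo (0 : ℝ) S).indicator (fun _ => (1 : ℝ)) (σ + s') * f σ)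
      (((volume : Measure ℝ).restrict (Ioo (0 : ℝ) S)).prod volume) := by
    have hm : Measurable
        (uncurry fun (s' σ : ℝ) => (Ioo (0 : ℝ) S).indicator (fun _ => (1 : ℝ)) (σ + s') * f σ) :=
      ((measurable_const.indicator measurableSet_Ioo).comp (measurable_snd.add measurable_fst)).mul
        (hfm.comp measurable_snd)
    -- bounded by `C`, vanishing unless `σ ∈ (-S, S)`
    have hswap : Integrable
        (uncurry fun (σ s' : ℝ) => (Ioo (0 : ℝ) S).indicator (fun _ => (1 : ℝ)) (σ + s') * f σ)
        ((volume : Measure ℝ).prod ((volume : Measure ℝ).restrict (Ioo (0 : ℝ) S))) := by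
      refine integrable_prod_restrict_of_bounded measurableSet_Ioo (by simp)
        (hm.comp measurable_swap).aestronglyMeasurable (C := C) (fun q => ?_)
        (s := Ioo (-S) S) measurableSet_Ioo (by simp) fun q hq hq1 => ?_
      · simp only [uncurry]
        rw [abs_mul]
        by_cases h : q.1 + q.2 ∈ Ioo (0 : ℝ) S
        · rw [indicator_of_mem h, abs_one, one_mul]; exact hfC _
        · rw [indicator_of_notMem h, abs_zero, zero_mul]; exact hC
      · simp only [uncurry]
        rw [indicator_of_notMem (fun h => hq1 ?_), zero_mul]
        simp only [mem_Ioo] at h hq ⊢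
        constructor <;> linarith [h.1, h.2, hq.1, hq.2]
    exact hswap.swap
  rw [integral_integral_swap h3]
  refine integral_congr_ae (ae_of_all _ fun σ => ?_)
  dsimp only
  rw [lagOverlap_apply, ← MeasureTheory.integral_mul_const]

end Overlap

variable {E : Type*} [NormedAddCommGroup E] [InnerProductSpace ℝ E] [FiniteDimensional ℝ E]
  [MeasurableSpace E] [BorelSpace E]

/-! ## Scaling in the velocity variable -/

section Scaling

/-- Change of variables `z = σ ξ` in the Bochner integral over `E`
(Mathlib's `Measure.integral_comp_smul`): for `σ ≠ 0`,
`∫ g(σ ξ) dξ = |σ^d|⁻¹ ∫ g(z) dz`, `d = dim E`. [folklore] -/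
theorem integral_comp_smul_eq (g : E → ℝ) (σ : ℝ) :
    ∫ ξ, g (σ • ξ) = |(σ ^ finrank ℝ E)⁻¹| * ∫ z, g z := by
  rw [Measure.integral_comp_smul volume g σ, smul_eq_mul]

/-- Change of variables in the lower Lebesgue integral over `E`: for `σ ≠ 0` and measurable `g`,
`∫⁻ g(σ⁻¹ z) dz = |σ^d| ∫⁻ g(ξ) dξ`. [folklore] -/
theorem lintegral_comp_inv_smul_eq {g : E → ℝ≥0∞} (hg : Measurable g) {σ : ℝ} (hσ : σ ≠ 0) :
    ∫⁻ z, g (σ⁻¹ • z) = ENNReal.ofReal |σ ^ finrank ℝ E| * ∫⁻ ξ, g ξ := by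
  have h := Measure.map_addHaar_smul (volume : Measure E) (inv_ne_zero hσ)
  rw [← lintegral_map hg (measurable_const_smul σ⁻¹), h, lintegral_smul_measure, inv_pow, inv_inv,
    smul_eq_mul]

end Scaling

/-! ## The `TT*` kernel -/

section Kernel

variable {ψ₀ : E → ℝ} {Cψ r S : ℝ}

/-- The **`TT*` kernel** of velocity averaging: `κ(σ, z) = W_S(σ) |σ^d|⁻¹ ψ₀(σ⁻¹ z)²` on
space-time `ℝ × E` (`d = dim E`; the value at `σ = 0` is immaterial). [folklore] -/
def ttKernel (ψ₀ : E → ℝ) (S : ℝ) (q : ℝ × E) : ℝ :=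
  lagOverlap S q.1 * (|(q.1 ^ finrank ℝ E)⁻¹| * ψ₀ (q.1⁻¹ • q.2) ^ 2)

omit [FiniteDimensional ℝ E] [MeasurableSpace E] [BorelSpace E] in
/-- Unfolding of `ttKernel`. [folklore] -/
theorem ttKernel_apply (ψ₀ : E → ℝ) (S : ℝ) (q : ℝ × E) :
    ttKernel ψ₀ S q = lagOverlap S q.1 * (|(q.1 ^ finrank ℝ E)⁻¹| * ψ₀ (q.1⁻¹ • q.2) ^ 2) := rfl

omit [FiniteDimensional ℝ E] [MeasurableSpace E] [BorelSpace E] in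
/-- `κ ≥ 0`. [folklore] -/
theorem ttKernel_nonneg (ψ₀ : E → ℝ) (S : ℝ) (q : ℝ × E) : 0 ≤ ttKernel ψ₀ S q :=
  mul_nonneg (lagOverlap_nonneg _ _) (mul_nonneg (abs_nonneg _) (sq_nonneg _))

/-- `κ` is measurable. [folklore] -/
theorem measurable_ttKernel (hψm : Measurable ψ₀) (S : ℝ) : Measurable (ttKernel ψ₀ S) := by
  unfold ttKernel
  refine ((measurable_lagOverlap S).comp measurable_fst).mul
    ((continuous_abs.measurable.comp (measurable_fst.pow_const _).inv).mul ?_)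
  exact (hψm.comp ((measurable_fst.inv).smul measurable_snd)).pow_const 2

/-- **`κ` is integrable**: `∫ |κ| ≤ (2S · S) ‖ψ₀‖₂²` (scale back `z = σ ξ` and use
`W_S ≤ S 1_{[-S,S]}`). [folklore] -/
theorem integrable_ttKernel (hψm : Measurable ψ₀) (hψb : ∀ ξ, |ψ₀ ξ| ≤ Cψ)
    (hψr : ∀ ξ, r < ‖ξ‖ → ψ₀ ξ = 0) (hS : 0 ≤ S) : Integrable (ttKernel ψ₀ S) volume := by
  have hCψ : 0 ≤ Cψ := (abs_nonneg _).trans (hψb 0)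
  refine ⟨(measurable_ttKernel hψm S).aestronglyMeasurable, ?_⟩
  -- `ψ₀²` has finite integral
  have hψ2 : ∫⁻ ξ, ENNReal.ofReal (ψ₀ ξ ^ 2) < ⊤ := by
    have hint : Integrable (fun ξ => ψ₀ ξ ^ 2) volume := by
      refine integrable_of_bounded_of_eq_zero ((hψm.pow_const 2).aestronglyMeasurable)
        (C := Cψ ^ 2) (fun ξ => ?_) (s := closedBall (0 : E) r)
        (isCompact_closedBall _ _).measure_lt_top (fun ξ hξ => ?_)
      · rw [abs_of_nonneg (sq_nonneg _), ← sq_abs]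
        exact pow_le_pow_left₀ (abs_nonneg _) (hψb ξ) 2
      · rw [hψr ξ (by simpa using hξ)]; ring
    have := hint.2
    simpa only [HasFiniteIntegral, Real.enorm_eq_ofReal (sq_nonneg _)] using this
  -- Tonelli
  unfold HasFiniteIntegral
  rw [Measure.volume_eq_prod, lintegral_prod _ (measurable_ttKernel hψm S).enorm.aemeasurable]
  -- the inner integral
  have hin : ∀ σ : ℝ, σ ≠ 0 → ∫⁻ z, ‖ttKernel ψ₀ S (σ, z)‖ₑ ∂volume =
      ENNReal.ofReal (lagOverlap S σ) * ∫⁻ ξ, ENNReal.ofReal (ψ₀ ξ ^ 2) := by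
    intro σ hσ
    have e1 : ∀ z : E, ‖ttKernel ψ₀ S (σ, z)‖ₑ = ENNReal.ofReal (lagOverlap S σ * |(σ ^ finrank ℝ E)⁻¹|) *
        ENNReal.ofReal (ψ₀ (σ⁻¹ • z) ^ 2) := fun z => by
      rw [Real.enorm_eq_ofReal (ttKernel_nonneg _ _ _), ttKernel_apply, ← mul_assoc,
        ENNReal.ofReal_mul (mul_nonneg (lagOverlap_nonneg _ _) (abs_nonneg _))]
    simp_rw [e1]
    have hmeas : Measurable fun z : E => ENNReal.ofReal (ψ₀ (σ⁻¹ • z) ^ 2) :=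
      ((hψm.comp (measurable_const_smul σ⁻¹)).pow_const 2).ennreal_ofReal
    rw [lintegral_const_mul _ hmeas,
      lintegral_comp_inv_smul_eq (g := fun ξ => ENNReal.ofReal (ψ₀ ξ ^ 2))
        (hψm.pow_const 2).ennreal_ofReal hσ, ← mul_assoc, ← ENNReal.ofReal_mul
        (mul_nonneg (lagOverlap_nonneg _ _) (abs_nonneg _)), mul_assoc, abs_inv,
      inv_mul_cancel₀ (abs_ne_zero.2 (pow_ne_zero _ hσ)), mul_one]
  have hae : ∀ᵐ σ : ℝ ∂volume, σ ≠ 0 := by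
    rw [ae_iff]; simp
  calc ∫⁻ σ, ∫⁻ z, ‖ttKernel ψ₀ S (σ, z)‖ₑ ∂volume ∂volume
      = ∫⁻ σ, ENNReal.ofReal (lagOverlap S σ) * ∫⁻ ξ, ENNReal.ofReal (ψ₀ ξ ^ 2) ∂volume := by
        refine lintegral_congr_ae (hae.mono fun σ hσ => hin σ hσ)
    _ ≤ ∫⁻ σ, (Icc (-S) S).indicator (fun _ => ENNReal.ofReal S) σ *
          ∫⁻ ξ, ENNReal.ofReal (ψ₀ ξ ^ 2) ∂volume := by
        refine lintegral_mono fun σ => ?_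
        gcongr
        by_cases hσ : σ ∈ Icc (-S) S
        · rw [indicator_of_mem hσ]; exact ENNReal.ofReal_le_ofReal (lagOverlap_le hS σ)
        · rw [indicator_of_notMem hσ, lagOverlap_eq_zero, ENNReal.ofReal_zero]
          rw [mem_Icc, not_and_or, not_le, not_le] at hσ
          rcases hσ with h | h
          · rw [abs_of_neg (by linarith)]; linarith
          · rw [abs_of_pos (by linarith)]; linarith
    _ = ENNReal.ofReal S * volume (Icc (-S) S) * ∫⁻ ξ, ENNReal.ofReal (ψ₀ ξ ^ 2) ∂volume := by
        rw [lintegral_mul_const _ (measurable_const.indicator measurableSet_Icc),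
          lintegral_indicator_const measurableSet_Icc]
    _ < ⊤ := by
        refine ENNReal.mul_lt_top (ENNReal.mul_lt_top ENNReal.ofReal_lt_top ?_) hψ2
        rw [Real.volume_Icc]; exact ENNReal.ofReal_lt_top

/-- **`A A* G = κ ∗ G` pointwise** for bounded measurable `G` and bounded measurable compactly
supported `ψ₀` (`0 ≤ S`): the velocity integral of `A*G` along the lags of `A` is reorganised by
the lag pushforward `σ = s - s'` (`integral_integral_sub_eq_integral_lagOverlap_mul`) and the
scaling `z = σ ξ` (`integral_comp_smul_eq`), which turns the velocity average into a
space-time convolution — the dispersion of free transport (Saint-Raymond 2009, §3.3.2). [folklore] -/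
theorem avgDuhamel_adjAvgDuhamel_eq (hψm : Measurable ψ₀) (hψb : ∀ ξ, |ψ₀ ξ| ≤ Cψ)
    (hψr : ∀ ξ, r < ‖ξ‖ → ψ₀ ξ = 0) (hS : 0 ≤ S)
    {G : ℝ × E → ℝ} (hGm : Measurable G) {B : ℝ} (hGb : ∀ p, |G p| ≤ B) (p : ℝ × E) :
    avgDuhamel ψ₀ S (adjAvgDuhamel ψ₀ S G) p = ∫ q, ttKernel ψ₀ S q * G (p - q) := by
  have hB : 0 ≤ B := (abs_nonneg _).trans (hGb 0)
  have hCψ : 0 ≤ Cψ := (abs_nonneg _).trans (hψb 0)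
  set I : Set ℝ := Ioo (0 : ℝ) S with hI
  -- the function `H ξ σ = ψ₀(ξ)² G(t - σ, x - σ ξ)`
  set H : E → ℝ → ℝ := fun ξ σ => ψ₀ ξ ^ 2 * G (p.1 - σ, p.2 - σ • ξ) with hH
  have hHm : Measurable (uncurry H) :=
    ((hψm.comp measurable_fst).pow_const 2).mul (hGm.comp (by fun_prop))
  have hHb : ∀ ξ σ, |H ξ σ| ≤ Cψ ^ 2 * B := fun ξ σ => by
    rw [hH]; simp only
    rw [abs_mul, abs_of_nonneg (sq_nonneg _), ← sq_abs]
    exact mul_le_mul (pow_le_pow_left₀ (abs_nonneg _) (hψb ξ) 2) (hGb _) (abs_nonneg _) (sq_nonneg _)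
  ---- Step 1: `A(A*G)(p) = ∫ dξ ∫_{(0,S)} ∫_{(0,S)} H ξ (s - s')`
  have h1 : avgDuhamel ψ₀ S (adjAvgDuhamel ψ₀ S G) p =
      ∫ ξ, ∫ s in I, ∫ s' in I, H ξ (s - s') := by
    rw [avgDuhamel_apply]
    refine integral_congr_ae (ae_of_all _ fun ξ => ?_)
    dsimp only
    rw [← MeasureTheory.integral_const_mul]
    refine setIntegral_congr_fun measurableSet_Ioo fun s _ => ?_
    rw [adjAvgDuhamel_apply]
    have e : ∀ s' : ℝ, G ((shear s (p.1, p.2, ξ)).1 + s',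
        (shear s (p.1, p.2, ξ)).2.1 + s' • (shear s (p.1, p.2, ξ)).2.2) =
        G (p.1 - (s - s'), p.2 - (s - s') • ξ) := fun s' => by
      congr 1
      simp only [shear]
      ext
      · ring
      · rw [sub_smul]; abel
    have e2 : (shear s (p.1, p.2, ξ)).2.2 = ξ := rfl
    simp_rw [e, e2]
    rw [← mul_assoc, ← sq, ← MeasureTheory.integral_const_mul]
  ---- Step 2: the lag pushforward, for each `ξ`
  have h2 : ∀ ξ, ∫ s in I, ∫ s' in I, H ξ (s - s') = ∫ σ, lagOverlap S σ * H ξ σ := fun ξ =>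
    integral_integral_sub_eq_integral_lagOverlap_mul (hHm.comp (measurable_const.prodMk
      measurable_id)) (hHb ξ)
  ---- Step 3: Fubini in `(ξ, σ)`
  have h3i : Integrable (uncurry fun ξ σ => lagOverlap S σ * H ξ σ)
      ((volume : Measure E).prod (volume : Measure ℝ)) := by
    have hm : Measurable (uncurry fun ξ σ => lagOverlap S σ * H ξ σ) :=
      ((measurable_lagOverlap S).comp measurable_snd).mul hHm
    refine integrable_of_bounded_of_eq_zero hm.aestronglyMeasurable (C := S * (Cψ ^ 2 * B))
      (fun q => ?_) (s := closedBall (0 : E) r ×ˢ Icc (-S) S) ?_ (fun q hq => ?_)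
    · simp only [uncurry]
      rw [abs_mul, abs_of_nonneg (lagOverlap_nonneg _ _)]
      exact mul_le_mul (lagOverlap_le hS _) (hHb _ _) (abs_nonneg _) hS
    · rw [Measure.prod_prod]
      exact ENNReal.mul_lt_top (isCompact_closedBall _ _).measure_lt_top
        (by rw [Real.volume_Icc]; exact ENNReal.ofReal_lt_top)
    · simp only [uncurry]
      rw [Set.mem_prod, not_and_or] at hq
      rcases hq with hq | hq
      · rw [hH]; simp only
        rw [hψr _ (by simpa using hq)]; ring
      · rw [lagOverlap_eq_zero, zero_mul]
        rw [mem_Icc, not_and_or, not_le, not_le] at hq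
        rcases hq with h | h
        · rw [abs_of_neg (by linarith)]; linarith
        · rw [abs_of_pos (by linarith)]; linarith
  have h3 : ∫ ξ, ∫ σ, lagOverlap S σ * H ξ σ = ∫ σ, ∫ ξ, lagOverlap S σ * H ξ σ :=
    integral_integral_swap h3i
  ---- Step 4: scaling `z = σ ξ` for `σ ≠ 0`
  have h4 : ∀ σ : ℝ, σ ≠ 0 → ∫ ξ, lagOverlap S σ * H ξ σ =
      ∫ z, ttKernel ψ₀ S (σ, z) * G (p.1 - σ, p.2 - z) := by
    intro σ hσ
    rw [MeasureTheory.integral_const_mul]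
    have e := integral_comp_smul_eq (fun z : E => ψ₀ (σ⁻¹ • z) ^ 2 * G (p.1 - σ, p.2 - z)) σ
    have e' : (fun ξ : E => (fun z : E => ψ₀ (σ⁻¹ • z) ^ 2 * G (p.1 - σ, p.2 - z)) (σ • ξ)) =
        fun ξ => H ξ σ := by
      funext ξ
      simp only [hH, inv_smul_smul₀ hσ]
    rw [e'] at e
    rw [e, ← mul_assoc, ← MeasureTheory.integral_const_mul]
    refine integral_congr_ae (ae_of_all _ fun z => ?_)
    simp only [ttKernel_apply]
    ring
  have hae : ∀ᵐ σ : ℝ ∂volume, σ ≠ 0 := by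
    rw [ae_iff]; simp
  have h4' : ∫ σ, ∫ ξ, lagOverlap S σ * H ξ σ =
      ∫ σ, ∫ z, ttKernel ψ₀ S (σ, z) * G (p.1 - σ, p.2 - z) :=
    integral_congr_ae (hae.mono fun σ hσ => h4 σ hσ)
  ---- Step 5: back to a single space-time integral
  have h5i : Integrable (fun q : ℝ × E => ttKernel ψ₀ S q * G (p - q)) volume := by
    refine ((integrable_ttKernel hψm hψb hψr hS).norm.mul_const B).mono' ?_ (ae_of_all _ fun q => ?_)
    · exact ((measurable_ttKernel hψm S).mul (hGm.comp (measurable_const.sub measurable_id))).aestronglyMeasurable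
    · rw [norm_mul, Real.norm_eq_abs, Real.norm_eq_abs]
      exact mul_le_mul_of_nonneg_left (hGb _) (abs_nonneg _)
  have h5 : ∫ q, ttKernel ψ₀ S q * G (p - q) =
      ∫ σ, ∫ z, ttKernel ψ₀ S (σ, z) * G (p.1 - σ, p.2 - z) := by
    rw [Measure.volume_eq_prod, integral_prod _ (by simpa [Measure.volume_eq_prod] using h5i)]
    rfl
  rw [h1]
  simp_rw [h2]
  rw [h3, h4', h5]

end Kernel

end Literature.MathematicalPhysics.KineticTheory
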